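import Summits.HodgeConjecture.CorCM.MumfordTateRankUnitaryPairBlocks
import Literature.Algebra.Lie.LineGradedIntertwiner
import HarnessLib

/-!
# Two unitary summands `H ≅ H₁ ⊕ H₂` of Ribet type `(m_i, 1)` in GRAPH position: an intertwiner `W₁ → W₂` of the derived algebra and of `Θ`
# (the unitary analogue of Moonen–Zarhin's Lemma (3.4), step 1 — the line-graded recognition lemma applied to the Hodge operator)

COR-CM (cell `pub-hodgecm2`, seat `b27` gen 52, count-neutral Mumford–Tate-rank ladder; theorems only, no definition, no named fact; UNCONDITIONAL —
nothing here uses or asserts HC_CM).  Abstract Hodge-structure level; consumer: the exact `{3,3}` cell of two simple type-IV(2,1) threefolds.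
SETTING.  `H ≅ H₁ ⊕ H₂` (`ι_i`, `π_i`) of weight one; `H_i` effective, polarized, with an imaginary quadratic Hodge endomorphism `φ_i` (`φ_i² = −d_i`,
`End_Hdg(H_i) = ℚ + ℚφ_i`) whose `μ_i`-eigenspace `W_i = ker(φ_{i,ℂ} − μ_i)` meets `H_i^{0,1}` in a line and `H_i^{1,0}` in dimension `≥ 2` (Ribet type
`(m_i,1)`: `𝔥(H_i) = 𝔲(W_i)`, `Motives/HodgeThetaSubalgebraUnitary`); `H₁` `Θ`-rigid.  GRAPH POSITION (`hK₁₂`, `hK₂₁`): an element of `𝔥(H) ⊗ ℂ` whose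
first block `π₁Zι₁` vanishes has second block in `ℂφ_{2,ℂ}`, and symmetrically (`…UnitaryPairSplitting` derives this from the simplicity of the
derived algebras when `𝔥(H) ⊉ ι₁[𝔥₁,𝔥₁]π₁`).
RESULT **`exists_intertwiner_blocks`**: a NON-ZERO `ℂ`-linear `S : H_{1,ℂ} → H_{2,ℂ}` supported on `W₁` (`Sφ_{1,ℂ} = μ₁S`), valued in `W₂`
(`φ_{2,ℂ}S = μ₂S`), intertwining the two blocks of every element of `[𝔥(H),𝔥(H)] ⊗ ℂ` and the blocks `Θ_i = π_iΘι_i` of the Hodge operator; and the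
TRACE IDENTITY `c·dim W₁ = dim W₁ − 2` for every derived element acting on `W₁` as `Θ₁ − c` (derived elements are traceless on `W₁`,
`Θ₁|_{W₁} = 1 − 2ℓ₁⊗f₁`).  PROOF: `Algebra/Lie/LineGradedIntertwiner.exists_intertwiner_lie` for `𝔤 = 𝔥(H) ⊗ ℂ ⊆ 𝔤𝔩(H_ℂ)` acting on `W₁`, `W₂`
through its blocks, graded by `D = Θ` (`exists_line_data`; both `ℓ`-entries of `Θ` are `−1`); kernel hypotheses = graph position since a block in
`𝔲(W_i) ⊗ ℂ` vanishing on `W_i` vanishes (`UnitaryTheta.eq_zero_of_forall_mem_eigenspace`); raising operators from `UnitaryTheta.exists_raising_W`,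
lifted to `𝔤` by `π₁𝔥(H)ι₁ = 𝔥(H₁)` (`map_restrict_eq_hodgeLie_of_rigid`); extension by the projector `(μ₁ + φ_{1,ℂ})/2μ₁` onto `W₁`.

## References
* [MoonenZarhin1999LowDim] B. Moonen, Yu. G. Zarhin, *Hodge classes on abelian varieties of low dimension*, Math. Ann. 315 (1999), §3 (3.1) and
  Lemma (3.4), §2 (2.3) [corpus: paper:arxiv-math_9901113 pp. 5–6]. [cite: MoonenZarhin1999LowDim, §3 (3.1) and Lemma (3.4)]
* [Ribet1983] K. A. Ribet, *Hodge classes on certain types of abelian varieties*, Amer. J. Math. 105 (1983), Thm. 3. [cite: Ribet1983, Thm. 3]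
* [Deligne1982HodgeCycles] P. Deligne, *Hodge cycles on abelian varieties*, LNM 900 (1982), I §3 Prop. 3.4, §4. [cite: Deligne1982HodgeCycles, I §3 Prop. 3.4]
-/

noncomputable section

open scoped TensorProduct

namespace Summit.HodgeConjecture.CorCM

namespace UnitaryPair

open Literature.AlgebraicGeometry.Motives Literature.AlgebraicGeometry.Motives.HodgeStructure Module

universe u

variable {V₁ : Type u} [AddCommGroup V₁] [Module ℚ V₁] [Module.Finite ℚ V₁]
  {V₂ : Type u} [AddCommGroup V₂] [Module ℚ V₂] [Module.Finite ℚ V₂]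
  {V : Type u} [AddCommGroup V] [Module ℚ V] [Module.Finite ℚ V] [HodgeTensorFacts.{u, u}] {n : ℤ}
  {H₁ : HodgeStructure V₁ n} {H₂ : HodgeStructure V₂ n} {H : HodgeStructure V n}
  (ι₁ : Hom H₁ H) (π₁ : Hom H H₁) (ι₂ : Hom H₂ H) (π₂ : Hom H H₂)
  (hπι₁ : ∀ v, π₁.toLinearMap (ι₁.toLinearMap v) = v) (hπι₂ : ∀ v, π₂.toLinearMap (ι₂.toLinearMap v) = v)
  (hsum : ∀ v, ι₁.toLinearMap (π₁.toLinearMap v) + ι₂.toLinearMap (π₂.toLinearMap v) = v)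

/-! ## The intertwiner -/

section Main

variable (hn : n = 1) (heff₁ : H₁.IsEffective) (heff₂ : H₂.IsEffective) (ψ₁ : H₁.Polarization) (ψ₂ : H₂.Polarization)
  {φ₁ : Module.End ℚ V₁} (hφ₁E : φ₁ ∈ H₁.endAlg) {d₁ : ℚ} (hd₁ : 0 < d₁) (hφ₁2 : φ₁ * φ₁ = -(d₁ • 1))
  (hE₁ : ∀ a ∈ H₁.endAlg, ∃ x y : ℚ, a = x • 1 + y • φ₁) {μ₁ : ℂ} (hμ₁ : μ₁ ^ 2 = -(d₁ : ℂ))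
  (h1₁ : Module.finrank ℂ ↥(Module.End.eigenspace (φ₁.baseChange ℂ) μ₁ ⊓ H₁.piece 0 1) = 1)
  (h2₁ : 2 ≤ Module.finrank ℂ ↥(Module.End.eigenspace (φ₁.baseChange ℂ) μ₁ ⊓ H₁.piece 1 0))
  {φ₂ : Module.End ℚ V₂} (hφ₂E : φ₂ ∈ H₂.endAlg) {d₂ : ℚ} (hd₂ : 0 < d₂) (hφ₂2 : φ₂ * φ₂ = -(d₂ • 1))
  (hE₂ : ∀ a ∈ H₂.endAlg, ∃ x y : ℚ, a = x • 1 + y • φ₂) {μ₂ : ℂ} (hμ₂ : μ₂ ^ 2 = -(d₂ : ℂ))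
  (h1₂ : Module.finrank ℂ ↥(Module.End.eigenspace (φ₂.baseChange ℂ) μ₂ ⊓ H₂.piece 0 1) = 1)
  (h2₂ : 2 ≤ Module.finrank ℂ ↥(Module.End.eigenspace (φ₂.baseChange ℂ) μ₂ ⊓ H₂.piece 1 0))
  (hrig₁ : ∀ 𝔞 : Submodule ℚ (Module.End ℚ V₁), 𝔞 ≤ H₁.hodgeLie →
      (∀ X ∈ 𝔞, ∀ Y ∈ 𝔞, X * Y - Y * X ∈ 𝔞) →
      (∃ Θ ∈ Submodule.span ℂ ((fun X : Module.End ℚ V₁ => X.baseChange ℂ) '' (𝔞 : Set (Module.End ℚ V₁))),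
        ∀ p, ∀ x ∈ H₁.piece p (n - p), Θ x = ((2 * p - n : ℤ) : ℂ) • x) → H₁.hodgeLie ≤ 𝔞)
  {Θ : Module.End ℂ (ℂ ⊗[ℚ] V)} (hΘ : ∀ p, ∀ x ∈ H.piece p (n - p), Θ x = ((2 * p - n : ℤ) : ℂ) • x)
  (hK₁₂ : ∀ Z ∈ spanC H.hodgeLie, π₁.toLinearMap.baseChange ℂ ∘ₗ Z ∘ₗ ι₁.toLinearMap.baseChange ℂ = 0 →
      ∃ k : ℂ, π₂.toLinearMap.baseChange ℂ ∘ₗ Z ∘ₗ ι₂.toLinearMap.baseChange ℂ = k • φ₂.baseChange ℂ)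
  (hK₂₁ : ∀ Z ∈ spanC H.hodgeLie, π₂.toLinearMap.baseChange ℂ ∘ₗ Z ∘ₗ ι₂.toLinearMap.baseChange ℂ = 0 →
      ∃ k : ℂ, π₁.toLinearMap.baseChange ℂ ∘ₗ Z ∘ₗ ι₁.toLinearMap.baseChange ℂ = k • φ₁.baseChange ℂ)

include hπι₁ hπι₂ hsum hn heff₁ heff₂ ψ₁ ψ₂ hφ₁E hd₁ hφ₁2 hE₁ hμ₁ h1₁ h2₁ hφ₂E hd₂ hφ₂2 hE₂ hμ₂ h1₂ h2₂ hrig₁ hΘ hK₁₂ hK₂₁ in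
set_option maxHeartbeats 800000 in
/-- **The intertwiner of a Goursat graph between two unitary Hodge Lie algebras.**  In the SETTING of the module docstring and in GRAPH
POSITION (`hK₁₂`, `hK₂₁`): there is a non-zero `ℂ`-linear `S : H_{1,ℂ} → H_{2,ℂ}` with `Sφ_{1,ℂ} = μ₁S`, `φ_{2,ℂ}S = μ₂S`, intertwining the two
blocks of every element of `[𝔥(H), 𝔥(H)] ⊗ ℂ` and the blocks of the Hodge operator `Θ`; moreover a derived element acting on `W₁` as `Θ₁ − c`
has `c·dim W₁ = dim W₁ − 2`.  (Line-graded recognition lemma for `𝔤 = 𝔥(H) ⊗ ℂ` on `W₁`, `W₂`, graded by `D = Θ`; raising operators of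
`UnitaryTheta.exists_raising_W` lifted by the rigidity of `H₁`; kernels by `UnitaryTheta.eq_zero_of_forall_mem_eigenspace`.)
[cite: MoonenZarhin1999LowDim, §3 (3.1) and Lemma (3.4)] [cite: Ribet1983, Thm. 3] [cite: Deligne1982HodgeCycles, I §3 Prop. 3.4] -/
theorem exists_intertwiner_blocks :
    ∃ S : ℂ ⊗[ℚ] V₁ →ₗ[ℂ] ℂ ⊗[ℚ] V₂, S ≠ 0 ∧ S ∘ₗ φ₁.baseChange ℂ = μ₁ • S ∧ φ₂.baseChange ℂ ∘ₗ S = μ₂ • S ∧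
      (∀ B ∈ spanC (Submodule.span ℚ {B | ∃ X ∈ H.hodgeLie, ∃ Y ∈ H.hodgeLie, X * Y - Y * X = B}),
        (π₂.toLinearMap.baseChange ℂ ∘ₗ B ∘ₗ ι₂.toLinearMap.baseChange ℂ) ∘ₗ S =
          S ∘ₗ (π₁.toLinearMap.baseChange ℂ ∘ₗ B ∘ₗ ι₁.toLinearMap.baseChange ℂ)) ∧
      (π₂.toLinearMap.baseChange ℂ ∘ₗ Θ ∘ₗ ι₂.toLinearMap.baseChange ℂ) ∘ₗ S =
        S ∘ₗ (π₁.toLinearMap.baseChange ℂ ∘ₗ Θ ∘ₗ ι₁.toLinearMap.baseChange ℂ) ∧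
      (∀ B ∈ spanC (Submodule.span ℚ {B | ∃ X ∈ H.hodgeLie, ∃ Y ∈ H.hodgeLie, X * Y - Y * X = B}), ∀ c : ℂ,
        (∀ w ∈ Module.End.eigenspace (φ₁.baseChange ℂ) μ₁, (π₁.toLinearMap.baseChange ℂ ∘ₗ B ∘ₗ ι₁.toLinearMap.baseChange ℂ) w =
          (π₁.toLinearMap.baseChange ℂ ∘ₗ Θ ∘ₗ ι₁.toLinearMap.baseChange ℂ) w - c • w) →
        c * (Module.finrank ℂ ↥(Module.End.eigenspace (φ₁.baseChange ℂ) μ₁) : ℂ) =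
          (Module.finrank ℂ ↥(Module.End.eigenspace (φ₁.baseChange ℂ) μ₁) : ℂ) - 2) := by
  classical
  subst hn
  letI : LieRing (Module.End ℂ (ℂ ⊗[ℚ] V)) := LieRing.ofAssociativeRing
  letI : LieAlgebra ℂ (Module.End ℂ (ℂ ⊗[ℚ] V)) := LieAlgebra.ofAssociativeAlgebra
  -- complex block maps
  let r₁ : Module.End ℂ (ℂ ⊗[ℚ] V) →ₗ[ℂ] Module.End ℂ (ℂ ⊗[ℚ] V₁) := (LinearMap.llcomp ℂ _ _ _ (π₁.toLinearMap.baseChange ℂ)).comp (LinearMap.lcomp ℂ _ (ι₁.toLinearMap.baseChange ℂ))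
  let r₂ : Module.End ℂ (ℂ ⊗[ℚ] V) →ₗ[ℂ] Module.End ℂ (ℂ ⊗[ℚ] V₂) := (LinearMap.llcomp ℂ _ _ _ (π₂.toLinearMap.baseChange ℂ)).comp (LinearMap.lcomp ℂ _ (ι₂.toLinearMap.baseChange ℂ))
  have hr₁ : ∀ Z, r₁ Z = π₁.toLinearMap.baseChange ℂ ∘ₗ Z ∘ₗ ι₁.toLinearMap.baseChange ℂ := fun Z => rfl
  have hr₂ : ∀ Z, r₂ Z = π₂.toLinearMap.baseChange ℂ ∘ₗ Z ∘ₗ ι₂.toLinearMap.baseChange ℂ := fun Z => rfl; clear_value r₁ r₂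
  have hπι₁' : π₁.toLinearMap ∘ₗ ι₁.toLinearMap = LinearMap.id := LinearMap.ext hπι₁
  have hπι₂' : π₂.toLinearMap ∘ₗ ι₂.toLinearMap = LinearMap.id := LinearMap.ext hπι₂
  have hq : ∀ (q : ℚ) (C : Module.End ℚ V), (q • C).baseChange ℂ = (q : ℂ) • C.baseChange ℂ := fun q C =>
    TensorProduct.AlgebraTensorModule.ext fun z v => by rw [LinearMap.baseChange_tmul, LinearMap.smul_apply, LinearMap.smul_apply,
      LinearMap.baseChange_tmul, TensorProduct.smul_tmul', ← TensorProduct.smul_tmul, Rat.smul_def, smul_eq_mul]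
  -- the Lie algebra `𝔤 = 𝔥(H) ⊗ ℂ`
  have hbr𝔥 : ∀ X ∈ H.hodgeLie, ∀ Y ∈ H.hodgeLie, X * Y - Y * X ∈ H.hodgeLie := fun X hX Y hY => H.commutator_mem_hodgeLie hX hY
  let 𝔏 : LieSubalgebra ℂ (Module.End ℂ (ℂ ⊗[ℚ] V)) :=
    { spanC H.hodgeLie with
      lie_mem' := fun {X Y} hX hY => by rw [Ring.lie_def]; exact commutator_mem_spanC hbr𝔥 hX hY }
  have hΘ𝔤 : Θ ∈ spanC H.hodgeLie := (hodgeLieC_eq_spanC H) ▸ H.mem_hodgeLieC_of_forall_piece hΘ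
  -- the blocks of `Θ` are Hodge operators
  obtain ⟨Θ₁, hΘ₁⟩ := exists_hodgeTheta H₁
  obtain ⟨Θ₂, hΘ₂⟩ := exists_hodgeTheta H₂
  have hrΘ₁ : r₁ Θ = Θ₁ := LinearMap.ext fun x => by rw [hr₁, LinearMap.comp_apply, LinearMap.comp_apply,
    theta_incl_eq H H₁ (fun p x hx => ι₁.map_piece_le p _ ⟨x, hx, rfl⟩) hΘ hΘ₁, proj_incl_baseChange hπι₁']
  have hrΘ₂ : r₂ Θ = Θ₂ := LinearMap.ext fun x => by rw [hr₂, LinearMap.comp_apply, LinearMap.comp_apply,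
    theta_incl_eq H H₂ (fun p x hx => ι₂.map_piece_le p _ ⟨x, hx, rfl⟩) hΘ hΘ₂, proj_incl_baseChange hπι₂']
  -- blocks of `𝔤` lie in `𝔲_i ⊗ ℂ`: they commute with `φ_{i,ℂ}` and are `ψ_i`-skew
  have hcomm₁ : ∀ X ∈ H₁.hodgeLie, ∀ a : H₁.endAlg, X * (a : Module.End ℚ V₁) = (a : Module.End ℚ V₁) * X := fun X hX a => commute_of_mem_hodgeLie H₁ hX a
  have hcomm₂ : ∀ X ∈ H₂.hodgeLie, ∀ a : H₂.endAlg, X * (a : Module.End ℚ V₂) = (a : Module.End ℚ V₂) * X := fun X hX a => commute_of_mem_hodgeLie H₂ hX a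
  have hskew₁ := fun X (hX : X ∈ H₁.hodgeLie) => form_apply_add_eq_zero_of_mem_hodgeLie ψ₁ hX
  have hskew₂ := fun X (hX : X ∈ H₂.hodgeLie) => form_apply_add_eq_zero_of_mem_hodgeLie ψ₂ hX
  have hr₁mem : ∀ Z ∈ spanC H.hodgeLie, r₁ Z ∈ spanC H₁.hodgeLie := fun Z hZ => by rw [hr₁]; exact restrict_mem_spanC ι₁ π₁ hπι₁ hZ
  have hr₂mem : ∀ Z ∈ spanC H.hodgeLie, r₂ Z ∈ spanC H₂.hodgeLie := fun Z hZ => by rw [hr₂]; exact restrict_mem_spanC ι₂ π₂ hπι₂ hZ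
  have hr₁φ : ∀ Z ∈ spanC H.hodgeLie, r₁ Z * φ₁.baseChange ℂ = φ₁.baseChange ℂ * r₁ Z := fun Z hZ => UnitaryTheta.commute_of_mem_spanC H₁ hφ₁E hcomm₁ (hr₁mem Z hZ)
  have hr₂φ : ∀ Z ∈ spanC H.hodgeLie, r₂ Z * φ₂.baseChange ℂ = φ₂.baseChange ℂ * r₂ Z := fun Z hZ => UnitaryTheta.commute_of_mem_spanC H₂ hφ₂E hcomm₂ (hr₂mem Z hZ)
  -- the eigenspaces `W_i` and the restricted representations `ρ_i`
  set W₁ := Module.End.eigenspace (φ₁.baseChange ℂ) μ₁ with hW₁def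
  set W₂ := Module.End.eigenspace (φ₂.baseChange ℂ) μ₂ with hW₂def
  have hW₁ : ∀ Z : 𝔏, ∀ w ∈ W₁, r₁ Z w ∈ W₁ := fun Z w hw => UnitaryTheta.apply_mem_eigenspace_of_commute (hr₁φ Z Z.2) hw
  have hW₂ : ∀ Z : 𝔏, ∀ w ∈ W₂, r₂ Z w ∈ W₂ := fun Z w hw => UnitaryTheta.apply_mem_eigenspace_of_commute (hr₂φ Z Z.2) hw
  let ρ₁ : 𝔏 →ₗ[ℂ] Module.End ℂ W₁ :=
    { toFun := fun Z => (r₁ Z).restrict (hW₁ Z)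
      map_add' := fun Z Z' => LinearMap.ext fun w => Subtype.ext (by
        simp only [LinearMap.coe_restrict_apply, LinearMap.add_apply, Submodule.coe_add]
        change r₁ ((Z : Module.End ℂ (ℂ ⊗[ℚ] V)) + Z') w = _
        rw [map_add, LinearMap.add_apply])
      map_smul' := fun c Z => LinearMap.ext fun w => Subtype.ext (by
        simp only [LinearMap.coe_restrict_apply, LinearMap.smul_apply, Submodule.coe_smul, RingHom.id_apply]
        change r₁ (c • (Z : Module.End ℂ (ℂ ⊗[ℚ] V))) w = _
        rw [map_smul, LinearMap.smul_apply]) }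
  let ρ₂ : 𝔏 →ₗ[ℂ] Module.End ℂ W₂ :=
    { toFun := fun Z => (r₂ Z).restrict (hW₂ Z)
      map_add' := fun Z Z' => LinearMap.ext fun w => Subtype.ext (by
        simp only [LinearMap.coe_restrict_apply, LinearMap.add_apply, Submodule.coe_add]
        change r₂ ((Z : Module.End ℂ (ℂ ⊗[ℚ] V)) + Z') w = _
        rw [map_add, LinearMap.add_apply])
      map_smul' := fun c Z => LinearMap.ext fun w => Subtype.ext (by
        simp only [LinearMap.coe_restrict_apply, LinearMap.smul_apply, Submodule.coe_smul, RingHom.id_apply]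
        change r₂ (c • (Z : Module.End ℂ (ℂ ⊗[ℚ] V))) w = _
        rw [map_smul, LinearMap.smul_apply]) }
  have hρ₁ : ∀ (Z : 𝔏) (w : W₁), ((ρ₁ Z w : W₁) : ℂ ⊗[ℚ] V₁) = r₁ Z w := fun Z w => rfl
  have hρ₂ : ∀ (Z : 𝔏) (w : W₂), ((ρ₂ Z w : W₂) : ℂ ⊗[ℚ] V₂) = r₂ Z w := fun Z w => rfl
  clear_value ρ₁ ρ₂
  have hbr₁ : ∀ X Y : 𝔏, ρ₁ ⁅X, Y⁆ = ρ₁ X * ρ₁ Y - ρ₁ Y * ρ₁ X := by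
    intro X Y
    refine LinearMap.ext fun w => Subtype.ext ?_
    rw [hρ₁, LieSubalgebra.coe_bracket, Ring.lie_def, map_sub, hr₁, restrict₁_mul_spanC ι₁ π₁ ι₂ π₂ hπι₁ hπι₂ hsum Y.2, hr₁,
      restrict₁_mul_spanC ι₁ π₁ ι₂ π₂ hπι₁ hπι₂ hsum X.2]
    simp only [LinearMap.sub_apply, Module.End.mul_apply, Submodule.coe_sub, hρ₁, hr₁]
  have hbr₂ : ∀ X Y : 𝔏, ρ₂ ⁅X, Y⁆ = ρ₂ X * ρ₂ Y - ρ₂ Y * ρ₂ X := by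
    intro X Y
    refine LinearMap.ext fun w => Subtype.ext ?_
    rw [hρ₂, LieSubalgebra.coe_bracket, Ring.lie_def, map_sub, hr₂, restrict₂_mul_spanC ι₁ π₁ ι₂ π₂ hπι₁ hπι₂ hsum Y.2, hr₂,
      restrict₂_mul_spanC ι₁ π₁ ι₂ π₂ hπι₁ hπι₂ hsum X.2]
    simp only [LinearMap.sub_apply, Module.End.mul_apply, Submodule.coe_sub, hρ₂, hr₂]
  -- the lines `W_i ∩ H_i^{0,1}` and their coordinates
  obtain ⟨ℓ₁, f₁, hfℓ₁, hℓ01₁, hℓ0₁, hQ₁, hL₁⟩ := exists_line_data (H₁ := H₁) rfl heff₁ hφ₁E h1₁ hΘ₁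
  obtain ⟨ℓ₂, f₂, hfℓ₂, hℓ01₂, hℓ0₂, hQ₂, hL₂⟩ := exists_line_data (H₁ := H₂) rfl heff₂ hφ₂E h1₂ hΘ₂
  obtain ⟨hP₁, -, hΘ10₁, hΘ01₁, -⟩ := UnitaryTheta.theta_facts H₁ rfl heff₁ hΘ₁
  obtain ⟨hP₂, -, hΘ10₂, hΘ01₂, -⟩ := UnitaryTheta.theta_facts H₂ rfl heff₂ hΘ₂
  set D : 𝔏 := ⟨Θ, hΘ𝔤⟩ with hDdef
  have hD₁ : ∀ u, ρ₁ D u = (1 : ℂ) • u + (-2 : ℂ) • f₁ u • ℓ₁ := fun u => Subtype.ext (by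
    rw [hρ₁, hDdef, hrΘ₁, Submodule.coe_add, Submodule.coe_smul, Submodule.coe_smul, Submodule.coe_smul, hQ₁ u]
    module)
  have hD₂ : ∀ u, ρ₂ D u = (1 : ℂ) • u + (-2 : ℂ) • f₂ u • ℓ₂ := fun u => Subtype.ext (by
    rw [hρ₂, hDdef, hrΘ₂, Submodule.coe_add, Submodule.coe_smul, Submodule.coe_smul, Submodule.coe_smul, hQ₂ u]
    module)
  -- nontriviality
  haveI : Nontrivial V₁ := Module.nontrivial_of_finrank_pos (R := ℚ) (by
    have h := Submodule.finrank_le (W₁ ⊓ H₁.piece 0 1); rw [Module.finrank_baseChange] at h; omega)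
  haveI : Nontrivial V₂ := Module.nontrivial_of_finrank_pos (R := ℚ) (by
    have h := Submodule.finrank_le (W₂ ⊓ H₂.piece 0 1); rw [Module.finrank_baseChange] at h; omega)
  -- the kernel hypotheses: a block vanishing on `W_i` vanishes
  have hK₁₂' : ∀ X : 𝔏, ρ₁ X = 0 → ∃ k : ℂ, ρ₂ X = k • 1 := by
    intro X hX
    have h0 : r₁ X = 0 :=
      UnitaryTheta.eq_zero_of_forall_mem_eigenspace H₁ ψ₁ hφ₁E hd₁ hφ₁2 hE₁ hμ₁ (hr₁φ X X.2)
        (ThetaSubalgebra.formBaseChange_add_eq_zero_of_mem_spanC ψ₁ hskew₁ (hr₁mem X X.2))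
        (fun w hw => by
          have h := congrArg (fun T : Module.End ℂ W₁ => ((T ⟨w, hw⟩ : W₁) : ℂ ⊗[ℚ] V₁)) hX
          simpa only [hρ₁, LinearMap.zero_apply, Submodule.coe_zero] using h)
    obtain ⟨k, hk⟩ := hK₁₂ X X.2 (by rw [← hr₁]; exact h0)
    refine ⟨k * μ₂, LinearMap.ext fun w => Subtype.ext ?_⟩
    rw [hρ₂, hr₂, hk, LinearMap.smul_apply, Module.End.mem_eigenspace_iff.1 w.2, LinearMap.smul_apply, Module.End.one_apply,
      Submodule.coe_smul, smul_smul]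
  have hK₂₁' : ∀ X : 𝔏, ρ₂ X = 0 → ∃ k : ℂ, ρ₁ X = k • 1 := by
    intro X hX
    have h0 : r₂ X = 0 :=
      UnitaryTheta.eq_zero_of_forall_mem_eigenspace H₂ ψ₂ hφ₂E hd₂ hφ₂2 hE₂ hμ₂ (hr₂φ X X.2)
        (ThetaSubalgebra.formBaseChange_add_eq_zero_of_mem_spanC ψ₂ hskew₂ (hr₂mem X X.2))
        (fun w hw => by
          have h := congrArg (fun T : Module.End ℂ W₂ => ((T ⟨w, hw⟩ : W₂) : ℂ ⊗[ℚ] V₂)) hX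
          simpa only [hρ₂, LinearMap.zero_apply, Submodule.coe_zero] using h)
    obtain ⟨k, hk⟩ := hK₂₁ X X.2 (by rw [← hr₂]; exact h0)
    refine ⟨k * μ₁, LinearMap.ext fun w => Subtype.ext ?_⟩
    rw [hρ₁, hr₁, hk, LinearMap.smul_apply, Module.End.mem_eigenspace_iff.1 w.2, LinearMap.smul_apply, Module.End.one_apply,
      Submodule.coe_smul, smul_smul]
  -- the raising operators of side `1`, lifted to `𝔤` by the rigidity of `H₁`
  have hΘ𝔤₁ : Θ₁ ∈ spanC H₁.hodgeLie := hrΘ₁ ▸ hr₁mem Θ hΘ𝔤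
  have hbr𝔥₁ : ∀ X ∈ H₁.hodgeLie, ∀ Y ∈ H₁.hodgeLie, X * Y - Y * X ∈ H₁.hodgeLie := fun X hX Y hY => H₁.commutator_mem_hodgeLie hX hY
  have himg : H.hodgeLie.map ((LinearMap.llcomp ℚ V₁ V V₁ π₁.toLinearMap).comp (LinearMap.lcomp ℚ V ι₁.toLinearMap)) = H₁.hodgeLie :=
    map_restrict_eq_hodgeLie_of_rigid ι₁ π₁ hπι₁ hrig₁ H.hodgeLie le_rfl hbr𝔥 ⟨Θ, hΘ𝔤, hΘ⟩
  have hraise' : ∀ y : W₁, f₁ y = 0 → ∃ X : 𝔏, ∀ u, ρ₁ X u = f₁ u • y := by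
    intro y hy
    have hy10 : (y : ℂ ⊗[ℚ] V₁) ∈ H₁.piece 1 0 := by
      have h := hQ₁ y
      rw [hy, zero_smul] at h
      have h' : (y : ℂ ⊗[ℚ] V₁) = (2 : ℂ)⁻¹ • ((y : ℂ ⊗[ℚ] V₁) + Θ₁ y) := by
        have : (2 : ℂ)⁻¹ • ((y : ℂ ⊗[ℚ] V₁) - Θ₁ y) = 0 := h.symm
        calc (y : ℂ ⊗[ℚ] V₁) = (2 : ℂ)⁻¹ • ((y : ℂ ⊗[ℚ] V₁) + Θ₁ y) + (2 : ℂ)⁻¹ • ((y : ℂ ⊗[ℚ] V₁) - Θ₁ y) := by module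
          _ = _ := by rw [this, add_zero]
      rw [h']
      exact hP₁ y
    obtain ⟨B, hB, hBℓ, hB0⟩ := UnitaryTheta.exists_raising_W H₁ rfl heff₁ ψ₁ hφ₁E hd₁ hφ₁2 hE₁ hμ₁ H₁.hodgeLie hbr𝔥₁ hΘ₁ hΘ𝔤₁
      hcomm₁ hskew₁ ℓ₁.2 hℓ01₁ hℓ0₁ hL₁ y.2 hy10
    rw [← himg] at hB
    obtain ⟨T, hT, hTB⟩ := exists_mem_spanC_map_eq ((LinearMap.llcomp ℚ V₁ V V₁ π₁.toLinearMap).comp (LinearMap.lcomp ℚ V ι₁.toLinearMap))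
      r₁ (fun X => by
        rw [hr₁]
        change _ = (π₁.toLinearMap ∘ₗ X ∘ₗ ι₁.toLinearMap).baseChange ℂ
        rw [LinearMap.baseChange_comp, LinearMap.baseChange_comp]) H.hodgeLie hB
    refine ⟨⟨T, hT⟩, fun u => Subtype.ext ?_⟩
    have hu : (u : ℂ ⊗[ℚ] V₁) = (2 : ℂ)⁻¹ • ((u : ℂ ⊗[ℚ] V₁) + Θ₁ u) + f₁ u • (ℓ₁ : ℂ ⊗[ℚ] V₁) := by
      rw [hQ₁ u]; module
    rw [hρ₁, Submodule.coe_smul]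
    change r₁ T u = _
    rw [hTB, hu, map_add, hB0 _ (hP₁ u), zero_add, map_smul, hBℓ]
  -- the recognition lemma
  obtain ⟨S, hSℓ, hSlie, hSZ⟩ := Literature.Algebra.Lie.LineGradedIntertwiner.exists_intertwiner_lie ρ₁ ρ₂ hbr₁ hbr₂ (D := D) (a := (1 : ℂ))
    (c := (-2 : ℂ)) (by norm_num) hfℓ₁ hD₁ hfℓ₂ hD₂ hK₁₂' hK₂₁' hraise'
  -- the projector onto `W₁` along `W̄₁` and the extended intertwiner
  obtain ⟨hμ0₁, -⟩ := UnitaryTheta.conj_eq_neg_of_sq hd₁ hμ₁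
  set eW : Module.End ℂ (ℂ ⊗[ℚ] V₁) := (2 * μ₁)⁻¹ • (μ₁ • 1 + φ₁.baseChange ℂ) with heWdef
  have hφφ₁ : ∀ x, φ₁.baseChange ℂ (φ₁.baseChange ℂ x) = (μ₁ * μ₁) • x := fun x => by
    rw [UnitaryTheta.baseChange_baseChange_apply hφ₁2, ← sq, hμ₁, neg_smul]
  have heW_mem : ∀ x, eW x ∈ W₁ := fun x => by
    rw [hW₁def, Module.End.mem_eigenspace_iff, heWdef]
    simp only [LinearMap.smul_apply, LinearMap.add_apply, Module.End.one_apply, map_smul, map_add, hφφ₁]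
    module
  have heW_id : ∀ w ∈ W₁, eW w = w := fun w hw => by
    rw [heWdef, LinearMap.smul_apply, LinearMap.add_apply, LinearMap.smul_apply, Module.End.one_apply, Module.End.mem_eigenspace_iff.1 hw,
      ← two_smul ℂ, smul_smul, smul_smul, mul_assoc, inv_mul_cancel₀ (mul_ne_zero two_ne_zero hμ0₁), one_smul]
  have heW_comm : ∀ T : Module.End ℂ (ℂ ⊗[ℚ] V₁), T * φ₁.baseChange ℂ = φ₁.baseChange ℂ * T → ∀ x, eW (T x) = T (eW x) := fun T hT x => by
    have h := congrArg (fun f => f x) hT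
    simp only [Module.End.mul_apply] at h
    simp only [heWdef, LinearMap.smul_apply, LinearMap.add_apply, Module.End.one_apply, map_smul, map_add, h]
  let P : ℂ ⊗[ℚ] V₁ →ₗ[ℂ] W₁ := LinearMap.codRestrict W₁ eW heW_mem
  have hP : ∀ x, ((P x : W₁) : ℂ ⊗[ℚ] V₁) = eW x := fun x => rfl; clear_value P
  set S' : ℂ ⊗[ℚ] V₁ →ₗ[ℂ] ℂ ⊗[ℚ] V₂ := W₂.subtype ∘ₗ S ∘ₗ P with hS'def
  have hS' : ∀ x, S' x = ((S (P x) : W₂) : ℂ ⊗[ℚ] V₂) := fun x => rfl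
  -- transport of intertwining relations from `W_i` to the blocks
  have hkey : ∀ Z : 𝔏, ρ₂ Z ∘ₗ S = S ∘ₗ ρ₁ Z → r₂ Z ∘ₗ S' = S' ∘ₗ r₁ Z := by
    intro Z hZ
    refine LinearMap.ext fun x => ?_
    have hPx : P (r₁ Z x) = ρ₁ Z (P x) := Subtype.ext (by rw [hP, hρ₁, hP, heW_comm _ (hr₁φ Z Z.2)])
    have h := congrArg (fun T : W₁ →ₗ[ℂ] W₂ => ((T (P x) : W₂) : ℂ ⊗[ℚ] V₂)) hZ
    simp only [LinearMap.comp_apply] at h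
    change r₂ Z (S' x) = S' (r₁ Z x)
    rw [hS', hS', hPx, ← h, hρ₂]
  refine ⟨S', fun h0 => hℓ0₂ ?_, ?_, ?_, fun B hB => ?_, ?_, fun B hB c hc => ?_⟩
  · -- `S' ℓ₁ = ℓ₂ ≠ 0`
    have h := congrArg (fun T => T (ℓ₁ : ℂ ⊗[ℚ] V₁)) h0
    simp only [LinearMap.zero_apply, hS'] at h
    have hPℓ : P (ℓ₁ : ℂ ⊗[ℚ] V₁) = ℓ₁ := Subtype.ext (by rw [hP, heW_id _ ℓ₁.2])
    rw [hPℓ, hSℓ] at h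
    exact h
  · -- supported on `W₁`
    refine LinearMap.ext fun x => ?_
    have hPx : P (φ₁.baseChange ℂ x) = μ₁ • P x := Subtype.ext (by
      rw [hP, Submodule.coe_smul, hP, heW_comm _ rfl, Module.End.mem_eigenspace_iff.1 (heW_mem x)])
    rw [LinearMap.comp_apply, LinearMap.smul_apply, hS', hS', hPx, map_smul, Submodule.coe_smul]
  · -- values in `W₂`
    refine LinearMap.ext fun x => ?_
    rw [LinearMap.comp_apply, LinearMap.smul_apply, hS', Module.End.mem_eigenspace_iff.1 (S (P x)).2]
  · -- the derived algebra
    induction hB using Submodule.span_induction with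
    | mem B hB =>
      obtain ⟨B', hB', rfl⟩ := hB
      dsimp only
      induction hB' using Submodule.span_induction with
      | mem C hC =>
        obtain ⟨X, hX, Y, hY, rfl⟩ := hC
        have h := hkey ⁅(⟨X.baseChange ℂ, baseChange_mem_spanC hX⟩ : 𝔏), ⟨Y.baseChange ℂ, baseChange_mem_spanC hY⟩⁆ (hSlie _ _)
        have hc : ((⁅(⟨X.baseChange ℂ, baseChange_mem_spanC hX⟩ : 𝔏), ⟨Y.baseChange ℂ, baseChange_mem_spanC hY⟩⁆ : 𝔏) :
            Module.End ℂ (ℂ ⊗[ℚ] V)) = (X * Y - Y * X).baseChange ℂ := by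
          rw [LieSubalgebra.coe_bracket, Ring.lie_def, LinearMap.baseChange_sub, LinearMap.baseChange_mul, LinearMap.baseChange_mul]
        rw [hc] at h
        rw [← hr₁ ((X * Y - Y * X).baseChange ℂ), ← hr₂ ((X * Y - Y * X).baseChange ℂ)]
        exact h
      | zero => simp only [LinearMap.baseChange_zero, LinearMap.comp_zero, LinearMap.zero_comp]
      | add C C' _ _ hC hC' => simp only [LinearMap.baseChange_add, LinearMap.comp_add, LinearMap.add_comp, hC, hC']
      | smul q C _ hC =>
        rw [hq]
        simp only [LinearMap.comp_smul, LinearMap.smul_comp, hC]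
    | zero => simp only [LinearMap.comp_zero, LinearMap.zero_comp]
    | add B B' _ _ hB hB' => simp only [LinearMap.comp_add, LinearMap.add_comp, hB, hB']
    | smul c B _ hB => simp only [LinearMap.comp_smul, LinearMap.smul_comp, hB]
  · -- the Hodge operator: its `ℓ`-entries are both `−1`
    have e₁ : ρ₁ D ℓ₁ = (-1 : ℂ) • ℓ₁ := by rw [hD₁, hfℓ₁]; module
    have e₂ : ρ₂ D ℓ₂ = (-1 : ℂ) • ℓ₂ := by rw [hD₂, hfℓ₂]; module
    have h := hkey D (hSZ D (by rw [e₁, e₂, LinearMap.map_smul, LinearMap.map_smul, hfℓ₁, hfℓ₂]))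
    rw [hDdef] at h
    rw [← hr₁ Θ, ← hr₂ Θ]
    exact h
  · -- the trace identity on `W₁`: derived elements are traceless, `tr(Θ|_{W₁}) = dim W₁ − 2`
    have h𝔡𝔥 : spanC (Submodule.span ℚ {B | ∃ X ∈ H.hodgeLie, ∃ Y ∈ H.hodgeLie, X * Y - Y * X = B}) ≤ spanC H.hodgeLie :=
      spanC_mono (Submodule.span_le.2 (by rintro _ ⟨X, hX, Y, hY, rfl⟩; exact hbr𝔥 X hX Y hY))
    set τ : 𝔏 →ₗ[ℂ] ℂ := LinearMap.trace ℂ W₁ ∘ₗ ρ₁ with hτdef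
    have hτ : ∀ Z : 𝔏, τ Z = LinearMap.trace ℂ W₁ (ρ₁ Z) := fun Z => rfl
    -- `τ` kills the complex span of the derived algebra
    have hkill : ∀ C ∈ Submodule.span ℚ {B | ∃ X ∈ H.hodgeLie, ∃ Y ∈ H.hodgeLie, X * Y - Y * X = B},
        ∃ h : C.baseChange ℂ ∈ spanC H.hodgeLie, τ ⟨C.baseChange ℂ, h⟩ = 0 := by
      intro C hC
      induction hC using Submodule.span_induction with
      | mem C hC =>
        obtain ⟨X, hX, Y, hY, rfl⟩ := hC
        refine ⟨baseChange_mem_spanC (hbr𝔥 X hX Y hY), ?_⟩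
        have he : (⟨(X * Y - Y * X).baseChange ℂ, baseChange_mem_spanC (hbr𝔥 X hX Y hY)⟩ : 𝔏) =
            ⁅(⟨X.baseChange ℂ, baseChange_mem_spanC hX⟩ : 𝔏), ⟨Y.baseChange ℂ, baseChange_mem_spanC hY⟩⁆ := Subtype.ext (by
          change (X * Y - Y * X).baseChange ℂ = _
          rw [LieSubalgebra.coe_bracket, Ring.lie_def, LinearMap.baseChange_sub, LinearMap.baseChange_mul, LinearMap.baseChange_mul])
        rw [he, hτ, hbr₁]
        refine (map_sub (LinearMap.trace ℂ W₁) _ _).trans ?_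
        rw [LinearMap.trace_mul_comm, sub_self]
      | zero =>
        refine ⟨by rw [LinearMap.baseChange_zero]; exact Submodule.zero_mem _, ?_⟩
        have he : (⟨(0 : Module.End ℚ V).baseChange ℂ, by rw [LinearMap.baseChange_zero]; exact Submodule.zero_mem _⟩ : 𝔏) = 0 :=
          Subtype.ext (LinearMap.baseChange_zero)
        rw [he, map_zero]
      | add C C' _ _ hC hC' =>
        obtain ⟨h, ht⟩ := hC
        obtain ⟨h', ht'⟩ := hC'
        refine ⟨by rw [LinearMap.baseChange_add]; exact Submodule.add_mem _ h h', ?_⟩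
        have he : (⟨(C + C').baseChange ℂ, by rw [LinearMap.baseChange_add]; exact Submodule.add_mem _ h h'⟩ : 𝔏) =
            ⟨C.baseChange ℂ, h⟩ + ⟨C'.baseChange ℂ, h'⟩ := Subtype.ext (LinearMap.baseChange_add _ _)
        rw [he, map_add, ht, ht', add_zero]
      | smul q C _ hC =>
        obtain ⟨h, ht⟩ := hC
        refine ⟨by rw [hq]; exact Submodule.smul_mem _ _ h, ?_⟩
        have he : (⟨(q • C).baseChange ℂ, by rw [hq]; exact Submodule.smul_mem _ _ h⟩ : 𝔏) = (q : ℂ) • ⟨C.baseChange ℂ, h⟩ :=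
          Subtype.ext (hq q C)
        rw [he, map_smul, ht, smul_zero]
    have htr : ∀ (B' : Module.End ℂ (ℂ ⊗[ℚ] V))
        (hB' : B' ∈ spanC (Submodule.span ℚ {B | ∃ X ∈ H.hodgeLie, ∃ Y ∈ H.hodgeLie, X * Y - Y * X = B})), τ ⟨B', h𝔡𝔥 hB'⟩ = 0 := by
      intro B' hB'
      induction hB' using Submodule.span_induction with
      | mem B hB =>
        obtain ⟨C, hC, rfl⟩ := hB
        obtain ⟨h, ht⟩ := hkill C hC
        exact ht
      | zero => exact (congrArg τ (Subtype.ext rfl : (⟨0, h𝔡𝔥 (Submodule.zero_mem _)⟩ : 𝔏) = 0)).trans (map_zero τ)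
      | add B B' hB hB' h h' =>
        have he : (⟨B + B', h𝔡𝔥 (Submodule.add_mem _ hB hB')⟩ : 𝔏) = ⟨B, h𝔡𝔥 hB⟩ + ⟨B', h𝔡𝔥 hB'⟩ := Subtype.ext rfl
        rw [he, map_add, h, h', add_zero]
      | smul c' B hB h =>
        have he : (⟨c' • B, h𝔡𝔥 (Submodule.smul_mem _ _ hB)⟩ : 𝔏) = c' • ⟨B, h𝔡𝔥 hB⟩ := Subtype.ext rfl
        rw [he, map_smul, h, smul_zero]
    -- `ρ₁⟨B⟩ = ρ₁ D − c` and `tr ρ₁ D = dim W₁ − 2`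
    have hρB : ρ₁ ⟨B, h𝔡𝔥 hB⟩ = ρ₁ D - c • (1 : Module.End ℂ W₁) := LinearMap.ext fun w => Subtype.ext (by
      rw [hρ₁, LinearMap.sub_apply, LinearMap.smul_apply, Module.End.one_apply, Submodule.coe_sub, Submodule.coe_smul, hρ₁, hDdef]
      exact (hr₁ B ▸ hr₁ Θ ▸ hc w w.2 :))
    have hρD : ρ₁ D = 1 + (-2 : ℂ) • f₁.smulRight ℓ₁ := LinearMap.ext fun u => by
      rw [hD₁, LinearMap.add_apply, LinearMap.smul_apply, Module.End.one_apply, LinearMap.smulRight_apply, one_smul]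
    have ht := htr B hB
    rw [hτ, hρB] at ht
    have h1 : LinearMap.trace ℂ W₁ (ρ₁ D - c • (1 : Module.End ℂ W₁)) =
        LinearMap.trace ℂ W₁ (ρ₁ D) - LinearMap.trace ℂ W₁ (c • (1 : Module.End ℂ W₁)) := map_sub (LinearMap.trace ℂ W₁) _ _
    have h2 : LinearMap.trace ℂ W₁ (c • (1 : Module.End ℂ W₁)) = c * (Module.finrank ℂ W₁ : ℂ) :=
      (map_smul (LinearMap.trace ℂ W₁) c 1).trans (by rw [LinearMap.trace_one, smul_eq_mul])
    have h3 : LinearMap.trace ℂ W₁ (ρ₁ D) = (Module.finrank ℂ W₁ : ℂ) - 2 := by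
      rw [hρD]
      refine (map_add (LinearMap.trace ℂ W₁) _ _).trans ?_
      rw [LinearMap.trace_one, (map_smul (LinearMap.trace ℂ W₁) (-2 : ℂ) _ : _), LinearMap.trace_smulRight, hfℓ₁]
      ring
    rw [h1, h2, h3] at ht
    linear_combination -ht

end Main

end UnitaryPair

end Summit.HodgeConjecture.CorCM

end
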